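import Summits.AtomisticToContinuum.FouriersLaw.Theses.StaticAbelianSqueeze
import Summits.AtomisticToContinuum.FouriersLaw.Theorems.LatticeLandauDampingAbelThermodynamicLimitFixedFrequencyMatchingPairSums
import Summits.AtomisticToContinuum.FouriersLaw.Theorems.EmbeddedDrudeMourreAbelThermodynamicLimitWitnessPositiveType
import Mathlib.MeasureTheory.Constructions.BorelSpace.Metrizable
import HarnessLib

/-!
# Contact layers from linear light cones — abstract half (part 1 of the reduction (M1) ⟸ (K3) ∧ (K2′))
(`--supports` helper for crux stmt-AtomisticToContinuum-13416, line `Sketch`, registered stub `stub_contactSplice` = (M1);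
pure real analysis, no chain objects; written by a stub-worker of the lead (c1); closes nothing)

Think of `a N i t` as the anchored sum `A^N_i(t) = Σ_k ⟨j_i(0) j_k(t)⟩_{N,T}` of the open `N`-chain (genuine bonds
`i ≤ N-2`) and of `C t` as the bulk summed current correlation `C_T(t)`.  Hypotheses (cone profile
`A e^{-(depth − v t⁺)/ℓ}`, `t⁺ = max t 0`):
 (hL) left-frame two-length cone  `|a N i t − a M i t| ≤ A e^{−((N−2−i) − vt⁺)/ℓ}`  (`N₀ ≤ N ≤ M`, `i + 2 ≤ N`),
 (hR) right-frame two-length cone `|a N (N−2−i) t − a M (M−2−i) t| ≤ A e^{−((N−2−i) − vt⁺)/ℓ}`,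
 (hB) linear-cone bulk identification `|a N i t − C t| ≤ A e^{−(min(i,N−2−i) − vt⁺)/ℓ}`.
Conclusions (`exists_contactLayer`): the one-bath layers `AL i t = lim_M a M i t`, `AR i t = lim_M a M (M−2−i) t` exist with
the cone rate kept (§2: Cauchy + `le_of_tendsto`) and are identified with the bulk beyond the cone,
`|AL i t − C t| ≤ A e^{−(i − vt⁺)/ℓ}` (§2); the contact function `E t = Σ_i (AL i t − C t) + Σ_i (AR i t − C t)` satisfies
`|E t| ≤ 2Aℓ′e^{vt⁺/ℓ}`, the SPLICE ESTIMATE `|Σ_{i<N−1} a N i t − (N−1) C t − E t| ≤ 4Aℓ′ e^{vt⁺/ℓ} r^{⌊(N−1)/2⌋}` (§3: split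
the bonds at `⌊(N−1)/2⌋`, read the right half from the right end, four geometric sums; `r = e^{−1/ℓ}`, `ℓ′ = (1−r)⁻¹`),
pointwise convergence `Σ_{i<N−1} a N i t − (N−1) C t → E t`, and measurability of `E` (pointwise limits,
`measurable_of_tendsto_metrizable`).  Part 2 (`…ContactSpliceOfLinearCones`) feeds the chain in.
All statements proved; `[folklore]`. No definitions.
-/

noncomputable section

namespace Summit.AtomisticToContinuum.FouriersLaw.Theorems.UniformAbelianRegularity.ZeroMeanDyadicSplice.LinearCone

open Filter Topology Set MeasureTheory

/-! ### §1 Elementary facts on the cone profile `A e^{-(d - s)/ℓ} = A e^{s/ℓ} r^d`, `r = e^{-1/ℓ}` -/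

/-- `0 ≤ r < 1` for `r = e^{-1/ℓ}`, `ℓ > 0`. [folklore] -/
theorem ratio_nonneg_lt_one {ℓ : ℝ} (hℓ : 0 < ℓ) : 0 ≤ Real.exp (-1 / ℓ) ∧ Real.exp (-1 / ℓ) < 1 :=
  ⟨(Real.exp_pos _).le, Real.exp_lt_one_iff.2 (by rw [neg_div]; exact neg_neg_of_pos (by positivity))⟩

/-- The cone profile in product form: `A e^{-(d-s)/ℓ} = A e^{s/ℓ} r^d`. [folklore] -/
theorem cone_eq (A s ℓ : ℝ) (d : ℕ) :
    A * Real.exp (-((d : ℝ) - s) / ℓ) = A * Real.exp (s / ℓ) * Real.exp (-1 / ℓ) ^ d := by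
  rw [← Real.exp_nat_mul, mul_assoc, ← Real.exp_add]
  congr 1; congr 1; ring

/-- The cone profile tends to `0` along `N ↦ N - k`. [folklore] -/
theorem tendsto_cone_sub {A s ℓ : ℝ} (hℓ : 0 < ℓ) (k : ℕ) :
    Tendsto (fun N : ℕ => A * Real.exp (-(((N - k : ℕ) : ℝ) - s) / ℓ)) atTop (𝓝 0) := by
  obtain ⟨hr0, hr1⟩ := ratio_nonneg_lt_one hℓ
  have h := ((tendsto_pow_atTop_nhds_zero_of_lt_one hr0 hr1).comp (tendsto_sub_atTop_nat k)).const_mul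
    (A * Real.exp (s / ℓ))
  rw [mul_zero] at h
  refine h.congr fun N => ?_
  simp only [Function.comp_apply, cone_eq]

/-- **A limit with the rate kept**, from a one-sided Cauchy bound valid from `N₁` on. [folklore] -/
theorem exists_tendsto_of_eventual_bound {u : ℕ → ℝ} {b : ℕ → ℝ} {N₁ : ℕ}
    (h : ∀ N M : ℕ, N₁ ≤ N → N ≤ M → |u N - u M| ≤ b N) (hb : Tendsto b atTop (𝓝 0)) :
    ∃ L : ℝ, Tendsto u atTop (𝓝 L) ∧ ∀ N : ℕ, N₁ ≤ N → |u N - L| ≤ b N := by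
  have hc : CauchySeq fun n => u (n + N₁) := by
    refine cauchySeq_of_le_tendsto_0' (fun n => b (n + N₁)) (fun n m hnm => ?_) ?_
    · rw [Real.dist_eq]; exact h _ _ (by omega) (by omega)
    · exact hb.comp (tendsto_add_atTop_nat N₁)
  obtain ⟨L, hL⟩ := cauchySeq_tendsto_of_complete hc
  have hu : Tendsto u atTop (𝓝 L) := (tendsto_add_atTop_iff_nat N₁).1 hL
  refine ⟨L, hu, fun N hN => ?_⟩
  have h1 : Tendsto (fun M => |u N - u M|) atTop (𝓝 |u N - L|) := (tendsto_const_nhds.sub hu).abs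
  exact le_of_tendsto h1 (eventually_atTop.2 ⟨N, fun M hM => h N M hN hM⟩)

/-- **Geometric majorant, infinite sum**: `|f i| ≤ B r^i` (`0 ≤ r < 1`, `B ≥ 0`) gives `f` summable and
`|Σ' f| ≤ B (1 - r)⁻¹`. [folklore] -/
theorem tsum_abs_le_of_geometric {f : ℕ → ℝ} {B r : ℝ} (hr0 : 0 ≤ r) (hr1 : r < 1)
    (h : ∀ i, |f i| ≤ B * r ^ i) : Summable f ∧ |∑' i, f i| ≤ B * (1 - r)⁻¹ := by
  have hg : Summable fun i => B * r ^ i := (summable_geometric_of_lt_one hr0 hr1).mul_left B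
  have hfa : Summable fun i => |f i| := Summable.of_nonneg_of_le (fun i => abs_nonneg _) h hg
  have hfs : Summable f := hfa.of_abs
  refine ⟨hfs, ?_⟩
  have h1 : ‖∑' i, f i‖ ≤ ∑' i, ‖f i‖ := norm_tsum_le_tsum_norm hfa
  simp only [Real.norm_eq_abs] at h1
  calc |∑' i, f i| ≤ ∑' i, |f i| := h1
    _ ≤ ∑' i, B * r ^ i := hfa.tsum_le_tsum h hg
    _ = B * (1 - r)⁻¹ := by rw [tsum_mul_left, tsum_geometric_of_lt_one hr0 hr1]

/-- **Geometric majorant, reflected finite sum**: `|g i| ≤ B r^{m-1-i}` for `i < m` gives `|Σ_{i<m} g i| ≤ B (1 - r)⁻¹`.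
[folklore] -/
theorem sum_abs_le_of_geometric_reflect {g : ℕ → ℝ} {B r : ℝ} (hr0 : 0 ≤ r) (hr1 : r < 1) (hB : 0 ≤ B) {m : ℕ}
    (h : ∀ i, i < m → |g i| ≤ B * r ^ (m - 1 - i)) : |∑ i ∈ Finset.range m, g i| ≤ B * (1 - r)⁻¹ := by
  calc |∑ i ∈ Finset.range m, g i| ≤ ∑ i ∈ Finset.range m, |g i| := Finset.abs_sum_le_sum_abs _ _
    _ ≤ ∑ i ∈ Finset.range m, B * r ^ (m - 1 - i) := Finset.sum_le_sum fun i hi => h i (Finset.mem_range.1 hi)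
    _ = B * ∑ i ∈ Finset.range m, r ^ i := by rw [← Finset.mul_sum, Finset.sum_range_reflect (fun i => r ^ i) m]
    _ ≤ B * (1 - r)⁻¹ := by
        refine mul_le_mul_of_nonneg_left ?_ hB
        rw [← tsum_geometric_of_lt_one hr0 hr1]
        exact (summable_geometric_of_lt_one hr0 hr1).sum_le_tsum _ (fun i _ => pow_nonneg hr0 i)

/-! ### §2 The one-bath layers as limits, with the cone rate kept -/

section Layers

variable {a : ℕ → ℕ → ℝ → ℝ} {C : ℝ → ℝ} {v ℓ A : ℝ} {N₀ : ℕ}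

/-- **Left contact layer**: under the left-frame two-length cone the rows `a M i t` converge as `M → ∞` to a layer
`AL i t` with `|a N i t - AL i t| ≤ A e^{-((N-2-i) - vt⁺)/ℓ}`. [folklore] -/
theorem exists_leftLayer (hℓ : 0 < ℓ)
    (hL : ∀ N M : ℕ, N₀ ≤ N → N ≤ M → ∀ i : ℕ, i + 2 ≤ N → ∀ t : ℝ,
      |a N i t - a M i t| ≤ A * Real.exp (-(((N - 2 - i : ℕ) : ℝ) - v * max t 0) / ℓ)) :
    ∃ AL : ℕ → ℝ → ℝ, ∀ (i : ℕ) (t : ℝ), Tendsto (fun M => a M i t) atTop (𝓝 (AL i t)) ∧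
      ∀ N : ℕ, N₀ ≤ N → i + 2 ≤ N →
        |a N i t - AL i t| ≤ A * Real.exp (-(((N - 2 - i : ℕ) : ℝ) - v * max t 0) / ℓ) := by
  have key : ∀ (i : ℕ) (t : ℝ), ∃ L : ℝ, Tendsto (fun M => a M i t) atTop (𝓝 L) ∧
      ∀ N : ℕ, max N₀ (i + 2) ≤ N → |a N i t - L| ≤ A * Real.exp (-(((N - 2 - i : ℕ) : ℝ) - v * max t 0) / ℓ) := by
    intro i t
    refine exists_tendsto_of_eventual_bound
      (fun N M hN hNM => hL N M (le_of_max_le_left hN) hNM i (le_of_max_le_right hN) t) ?_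
    refine (tendsto_cone_sub (A := A) (s := v * max t 0) hℓ (2 + i)).congr fun N => ?_
    rw [Nat.sub_sub]
  choose AL hAL using key
  exact ⟨AL, fun i t => ⟨(hAL i t).1, fun N hN hi => (hAL i t).2 N (max_le hN hi)⟩⟩

/-- **Right contact layer**: under the right-frame two-length cone the rows `a M (M-2-i) t` (right-depth `i`) converge
to `AR i t` with `|a N (N-2-i) t - AR i t| ≤ A e^{-((N-2-i) - vt⁺)/ℓ}`. [folklore] -/
theorem exists_rightLayer (hℓ : 0 < ℓ)
    (hR : ∀ N M : ℕ, N₀ ≤ N → N ≤ M → ∀ i : ℕ, i + 2 ≤ N → ∀ t : ℝ,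
      |a N (N - 2 - i) t - a M (M - 2 - i) t| ≤ A * Real.exp (-(((N - 2 - i : ℕ) : ℝ) - v * max t 0) / ℓ)) :
    ∃ AR : ℕ → ℝ → ℝ, ∀ (i : ℕ) (t : ℝ), Tendsto (fun M => a M (M - 2 - i) t) atTop (𝓝 (AR i t)) ∧
      ∀ N : ℕ, N₀ ≤ N → i + 2 ≤ N →
        |a N (N - 2 - i) t - AR i t| ≤ A * Real.exp (-(((N - 2 - i : ℕ) : ℝ) - v * max t 0) / ℓ) := by
  have key : ∀ (i : ℕ) (t : ℝ), ∃ L : ℝ, Tendsto (fun M => a M (M - 2 - i) t) atTop (𝓝 L) ∧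
      ∀ N : ℕ, max N₀ (i + 2) ≤ N →
        |a N (N - 2 - i) t - L| ≤ A * Real.exp (-(((N - 2 - i : ℕ) : ℝ) - v * max t 0) / ℓ) := by
    intro i t
    refine exists_tendsto_of_eventual_bound (u := fun M => a M (M - 2 - i) t)
      (fun N M hN hNM => hR N M (le_of_max_le_left hN) hNM i (le_of_max_le_right hN) t) ?_
    refine (tendsto_cone_sub (A := A) (s := v * max t 0) hℓ (2 + i)).congr fun N => ?_
    rw [Nat.sub_sub]
  choose AR hAR using key
  exact ⟨AR, fun i t => ⟨(hAR i t).1, fun N hN hi => (hAR i t).2 N (max_le hN hi)⟩⟩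

/-- **Bulk identification of the left layer** (the linear-cone bulk identification passed to the limit):
`|AL i t - C t| ≤ A e^{-(i - vt⁺)/ℓ}`. [folklore] -/
theorem leftLayer_sub_bulk
    (hB : ∀ N : ℕ, N₀ ≤ N → ∀ i : ℕ, i + 2 ≤ N → ∀ t : ℝ,
      |a N i t - C t| ≤ A * Real.exp (-(((min i (N - 2 - i) : ℕ) : ℝ) - v * max t 0) / ℓ))
    {AL : ℕ → ℝ → ℝ} (hAL : ∀ (i : ℕ) (t : ℝ), Tendsto (fun M => a M i t) atTop (𝓝 (AL i t)))
    (i : ℕ) (t : ℝ) : |AL i t - C t| ≤ A * Real.exp (-((i : ℝ) - v * max t 0) / ℓ) := by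
  have h1 : Tendsto (fun M => |a M i t - C t|) atTop (𝓝 |AL i t - C t|) :=
    ((hAL i t).sub tendsto_const_nhds).abs
  refine le_of_tendsto h1 (eventually_atTop.2 ⟨max N₀ (2 * i + 2), fun M hM => ?_⟩)
  have hM1 : N₀ ≤ M := le_of_max_le_left hM
  have hM2 : 2 * i + 2 ≤ M := le_of_max_le_right hM
  have h := hB M hM1 i (by omega) t
  rwa [min_eq_left (by omega : i ≤ M - 2 - i)] at h

/-- **Bulk identification of the right layer**: `|AR i t - C t| ≤ A e^{-(i - vt⁺)/ℓ}`. [folklore] -/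
theorem rightLayer_sub_bulk
    (hB : ∀ N : ℕ, N₀ ≤ N → ∀ i : ℕ, i + 2 ≤ N → ∀ t : ℝ,
      |a N i t - C t| ≤ A * Real.exp (-(((min i (N - 2 - i) : ℕ) : ℝ) - v * max t 0) / ℓ))
    {AR : ℕ → ℝ → ℝ} (hAR : ∀ (i : ℕ) (t : ℝ), Tendsto (fun M => a M (M - 2 - i) t) atTop (𝓝 (AR i t)))
    (i : ℕ) (t : ℝ) : |AR i t - C t| ≤ A * Real.exp (-((i : ℝ) - v * max t 0) / ℓ) := by
  have h1 : Tendsto (fun M => |a M (M - 2 - i) t - C t|) atTop (𝓝 |AR i t - C t|) :=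
    ((hAR i t).sub tendsto_const_nhds).abs
  refine le_of_tendsto h1 (eventually_atTop.2 ⟨max N₀ (2 * i + 2), fun M hM => ?_⟩)
  have hM1 : N₀ ≤ M := le_of_max_le_left hM
  have hM2 : 2 * i + 2 ≤ M := le_of_max_le_right hM
  have h := hB M hM1 (M - 2 - i) (by omega) t
  have e1 : M - 2 - (M - 2 - i) = i := by omega
  rwa [e1, min_eq_right (by omega : i ≤ M - 2 - i)] at h

end Layers

/-! ### §3 The splice estimate: splitting the bonds at `N/2` -/

section Splice

variable {a : ℕ → ℕ → ℝ → ℝ} {C : ℝ → ℝ} {v ℓ A : ℝ} {N₀ : ℕ}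

/-- **The splice estimate.** With the two layers `AL, AR` (cone rates `hALr, hARr`) identified with the bulk beyond the
cone (`hALb, hARb`), the contact function `E(t) = Σ_i (AL i t - C t) + Σ_i (AR i t - C t)` satisfies, for `N ≥ N₀`,
`|Σ_{i<N-1} a N i t - (N-1) C t - E t| ≤ 4Aℓ′ e^{vt⁺/ℓ} r^{⌊(N-1)/2⌋}` (`r = e^{-1/ℓ}`, `ℓ′ = (1-r)⁻¹`): split the bonds
at `m = ⌊(N-1)/2⌋`, read the right half from the right end, and bound the four pieces by geometric sums. [folklore] -/
theorem splice_estimate (hℓ : 0 < ℓ) (hA : 0 ≤ A) {AL AR : ℕ → ℝ → ℝ}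
    (hALr : ∀ (i : ℕ) (t : ℝ) (N : ℕ), N₀ ≤ N → i + 2 ≤ N →
      |a N i t - AL i t| ≤ A * Real.exp (-(((N - 2 - i : ℕ) : ℝ) - v * max t 0) / ℓ))
    (hARr : ∀ (i : ℕ) (t : ℝ) (N : ℕ), N₀ ≤ N → i + 2 ≤ N →
      |a N (N - 2 - i) t - AR i t| ≤ A * Real.exp (-(((N - 2 - i : ℕ) : ℝ) - v * max t 0) / ℓ))
    (hALb : ∀ (i : ℕ) (t : ℝ), |AL i t - C t| ≤ A * Real.exp (-((i : ℝ) - v * max t 0) / ℓ))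
    (hARb : ∀ (i : ℕ) (t : ℝ), |AR i t - C t| ≤ A * Real.exp (-((i : ℝ) - v * max t 0) / ℓ))
    (N : ℕ) (hN : N₀ ≤ N) (hN1 : 1 ≤ N) (t : ℝ) :
    (Summable fun i => AL i t - C t) ∧ (Summable fun i => AR i t - C t) ∧
    |(∑ i ∈ Finset.range (N - 1), a N i t) - ((N : ℝ) - 1) * C t -
        ((∑' i, (AL i t - C t)) + ∑' i, (AR i t - C t))| ≤
      4 * A * (1 - Real.exp (-1 / ℓ))⁻¹ * Real.exp (v * max t 0 / ℓ) * Real.exp (-1 / ℓ) ^ ((N - 1) / 2) := by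
  obtain ⟨hr0, hr1⟩ := ratio_nonneg_lt_one hℓ
  set r := Real.exp (-1 / ℓ) with hr
  set s := v * max t 0 with hs
  set n := N - 1 with hn
  set m := n / 2 with hm
  have hmn : m ≤ n := Nat.div_le_self _ _
  have hmnm : m ≤ n - m := by omega
  have hNn : (N : ℝ) - 1 = n := by rw [hn, Nat.cast_sub hN1, Nat.cast_one]
  -- summable layers
  have hgL : ∀ i, |AL i t - C t| ≤ A * Real.exp (s / ℓ) * r ^ i := fun i => by rw [← cone_eq]; exact hALb i t
  have hgR : ∀ i, |AR i t - C t| ≤ A * Real.exp (s / ℓ) * r ^ i := fun i => by rw [← cone_eq]; exact hARb i t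
  have hsL : Summable fun i => AL i t - C t := (tsum_abs_le_of_geometric hr0 hr1 hgL).1
  have hsR : Summable fun i => AR i t - C t := (tsum_abs_le_of_geometric hr0 hr1 hgR).1
  refine ⟨hsL, hsR, ?_⟩
  -- split the series and the finite sum, and regroup
  rw [← hsL.sum_add_tsum_nat_add m, ← hsR.sum_add_tsum_nat_add (n - m)]
  have hsplit : ∑ i ∈ Finset.range n, a N i t =
      ∑ i ∈ Finset.range m, a N i t + ∑ d ∈ Finset.range (n - m), a N (n - 1 - d) t := by
    have h1 := Finset.sum_range_add (fun i => a N i t) m (n - m)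
    rw [Nat.add_sub_cancel' hmn] at h1
    rw [h1]
    congr 1
    rw [← Finset.sum_range_reflect (fun j => a N (m + j) t) (n - m)]
    refine Finset.sum_congr rfl fun d hd => ?_
    have hd' := Finset.mem_range.1 hd
    show a N (m + (n - m - 1 - d)) t = a N (n - 1 - d) t
    congr 1; omega
  have hC : ((N : ℝ) - 1) * C t = ∑ _i ∈ Finset.range m, C t + ∑ _d ∈ Finset.range (n - m), C t := by
    rw [Finset.sum_const, Finset.sum_const, Finset.card_range, Finset.card_range, nsmul_eq_mul, nsmul_eq_mul,
      ← add_mul, hNn, Nat.cast_sub hmn]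
    ring
  rw [hsplit, hC]
  have e : (∑ i ∈ Finset.range m, a N i t + ∑ d ∈ Finset.range (n - m), a N (n - 1 - d) t) -
      (∑ _i ∈ Finset.range m, C t + ∑ _d ∈ Finset.range (n - m), C t) -
      ((∑ i ∈ Finset.range m, (AL i t - C t) + ∑' i, (AL (i + m) t - C t)) +
        (∑ i ∈ Finset.range (n - m), (AR i t - C t) + ∑' i, (AR (i + (n - m)) t - C t))) =
      (∑ i ∈ Finset.range m, (a N i t - AL i t)) + (∑ d ∈ Finset.range (n - m), (a N (n - 1 - d) t - AR d t)) -
        (∑' i, (AL (i + m) t - C t)) - ∑' i, (AR (i + (n - m)) t - C t) := by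
    simp only [Finset.sum_sub_distrib]; ring
  rw [e]
  -- the four geometric bounds
  set B₁ := A * Real.exp (s / ℓ) * r ^ (n - m) with hB₁
  set B₂ := A * Real.exp (s / ℓ) * r ^ m with hB₂
  have hB₁0 : 0 ≤ B₁ := by positivity
  have hB₂0 : 0 ≤ B₂ := by positivity
  have h1 : |∑ i ∈ Finset.range m, (a N i t - AL i t)| ≤ B₁ * (1 - r)⁻¹ := by
    refine sum_abs_le_of_geometric_reflect hr0 hr1 hB₁0 fun i hi => ?_
    have h := hALr i t N hN (by omega)
    rw [cone_eq] at h
    have e2 : N - 2 - i = (n - m) + (m - 1 - i) := by omega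
    rwa [e2, pow_add, ← mul_assoc] at h
  have h2 : |∑ d ∈ Finset.range (n - m), (a N (n - 1 - d) t - AR d t)| ≤ B₂ * (1 - r)⁻¹ := by
    refine sum_abs_le_of_geometric_reflect hr0 hr1 hB₂0 fun d hd => ?_
    have h := hARr d t N hN (by omega)
    rw [cone_eq] at h
    have e2 : Real.exp (-1 / ℓ) ^ (N - 2 - d) = Real.exp (-1 / ℓ) ^ m * Real.exp (-1 / ℓ) ^ (n - m - 1 - d) := by
      rw [← pow_add]; congr 1; omega
    have e3 : n - 1 - d = N - 2 - d := by omega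
    rw [e2, ← mul_assoc] at h
    rwa [e3]
  have h3 : |∑' i, (AL (i + m) t - C t)| ≤ B₂ * (1 - r)⁻¹ := by
    refine (tsum_abs_le_of_geometric hr0 hr1 fun i => ?_).2
    have h := hgL (i + m)
    rwa [pow_add, mul_comm (r ^ i), ← mul_assoc] at h
  have h4 : |∑' i, (AR (i + (n - m)) t - C t)| ≤ B₁ * (1 - r)⁻¹ := by
    refine (tsum_abs_le_of_geometric hr0 hr1 fun i => ?_).2
    have h := hgR (i + (n - m))
    rwa [pow_add, mul_comm (r ^ i), ← mul_assoc] at h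
  have hl0 : 0 ≤ (1 - r)⁻¹ := inv_nonneg.2 (by linarith)
  have hB12 : B₁ * (1 - r)⁻¹ ≤ B₂ * (1 - r)⁻¹ := by
    refine mul_le_mul_of_nonneg_right ?_ hl0
    exact mul_le_mul_of_nonneg_left (pow_le_pow_of_le_one hr0 hr1.le hmnm) (by positivity)
  calc |(∑ i ∈ Finset.range m, (a N i t - AL i t)) + (∑ d ∈ Finset.range (n - m), (a N (n - 1 - d) t - AR d t)) -
          (∑' i, (AL (i + m) t - C t)) - ∑' i, (AR (i + (n - m)) t - C t)|
      ≤ |(∑ i ∈ Finset.range m, (a N i t - AL i t)) + (∑ d ∈ Finset.range (n - m), (a N (n - 1 - d) t - AR d t)) -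
          (∑' i, (AL (i + m) t - C t))| + |∑' i, (AR (i + (n - m)) t - C t)| := abs_sub _ _
    _ ≤ |(∑ i ∈ Finset.range m, (a N i t - AL i t)) + (∑ d ∈ Finset.range (n - m), (a N (n - 1 - d) t - AR d t))| +
          |∑' i, (AL (i + m) t - C t)| + |∑' i, (AR (i + (n - m)) t - C t)| := by
        gcongr; exact abs_sub _ _
    _ ≤ |∑ i ∈ Finset.range m, (a N i t - AL i t)| + |∑ d ∈ Finset.range (n - m), (a N (n - 1 - d) t - AR d t)| +
          |∑' i, (AL (i + m) t - C t)| + |∑' i, (AR (i + (n - m)) t - C t)| := by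
        gcongr; exact abs_add_le _ _
    _ ≤ B₁ * (1 - r)⁻¹ + B₂ * (1 - r)⁻¹ + B₂ * (1 - r)⁻¹ + B₁ * (1 - r)⁻¹ := by gcongr
    _ ≤ 4 * (B₂ * (1 - r)⁻¹) := by linarith
    _ = 4 * A * (1 - r)⁻¹ * Real.exp (s / ℓ) * r ^ m := by simp only [hB₂]; ring

end Splice

/-! ### §4 The abstract contact-layer theorem -/

section Main

variable {a : ℕ → ℕ → ℝ → ℝ} {C : ℝ → ℝ} {v ℓ A : ℝ} {N₀ : ℕ}

/-- **Contact layers from linear cones (abstract form).** Let `a N i t` (think: the anchored sums `A^N_i(t)` of the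
open `N`-chain, `i ≤ N-2`) and `C t` (the bulk summed correlation) satisfy the left- and right-frame TWO-LENGTH LINEAR
CONES `hL, hR` and the LINEAR-CONE BULK IDENTIFICATION `hB` (profile `A e^{-(depth - vt⁺)/ℓ}`, `t⁺ = max t 0`). Then
there is a contact function `E` (the sum of the two one-bath layers minus bulk) with:
`|E t| ≤ 2Aℓ′e^{vt⁺/ℓ}`; the SPLICE `|Σ_{i<N-1} a N i t - (N-1)C t - E t| ≤ 4Aℓ′e^{vt⁺/ℓ} r^{⌊(N-1)/2⌋}` for `N ≥ N₀`,
`N ≥ 1`, all `t` (`r = e^{-1/ℓ}`, `ℓ′ = (1-r)⁻¹`); pointwise convergence `Σ_{i<N-1} a N i t - (N-1)C t → E t`; and `E`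
is measurable as soon as every `t ↦ a N i t` and `C` are. [folklore] -/
theorem exists_contactLayer (hℓ : 0 < ℓ) (hA : 0 ≤ A)
    (hL : ∀ N M : ℕ, N₀ ≤ N → N ≤ M → ∀ i : ℕ, i + 2 ≤ N → ∀ t : ℝ,
      |a N i t - a M i t| ≤ A * Real.exp (-(((N - 2 - i : ℕ) : ℝ) - v * max t 0) / ℓ))
    (hR : ∀ N M : ℕ, N₀ ≤ N → N ≤ M → ∀ i : ℕ, i + 2 ≤ N → ∀ t : ℝ,
      |a N (N - 2 - i) t - a M (M - 2 - i) t| ≤ A * Real.exp (-(((N - 2 - i : ℕ) : ℝ) - v * max t 0) / ℓ))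
    (hB : ∀ N : ℕ, N₀ ≤ N → ∀ i : ℕ, i + 2 ≤ N → ∀ t : ℝ,
      |a N i t - C t| ≤ A * Real.exp (-(((min i (N - 2 - i) : ℕ) : ℝ) - v * max t 0) / ℓ)) :
    ∃ E : ℝ → ℝ,
      (∀ t : ℝ, |E t| ≤ 2 * A * (1 - Real.exp (-1 / ℓ))⁻¹ * Real.exp (v * max t 0 / ℓ)) ∧
      (∀ N : ℕ, N₀ ≤ N → 1 ≤ N → ∀ t : ℝ,
        |(∑ i ∈ Finset.range (N - 1), a N i t) - ((N : ℝ) - 1) * C t - E t| ≤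
          4 * A * (1 - Real.exp (-1 / ℓ))⁻¹ * Real.exp (v * max t 0 / ℓ) * Real.exp (-1 / ℓ) ^ ((N - 1) / 2)) ∧
      (∀ t : ℝ, Tendsto (fun N : ℕ => (∑ i ∈ Finset.range (N - 1), a N i t) - ((N : ℝ) - 1) * C t)
        atTop (𝓝 (E t))) ∧
      ((∀ N i : ℕ, Measurable fun t => a N i t) → Measurable C → Measurable E) := by
  obtain ⟨hr0, hr1⟩ := ratio_nonneg_lt_one hℓ
  obtain ⟨AL, hAL⟩ := exists_leftLayer hℓ hL
  obtain ⟨AR, hAR⟩ := exists_rightLayer hℓ hR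
  have hALt : ∀ (i : ℕ) (t : ℝ), Tendsto (fun M => a M i t) atTop (𝓝 (AL i t)) := fun i t => (hAL i t).1
  have hARt : ∀ (i : ℕ) (t : ℝ), Tendsto (fun M => a M (M - 2 - i) t) atTop (𝓝 (AR i t)) := fun i t => (hAR i t).1
  have hALr : ∀ (i : ℕ) (t : ℝ) (N : ℕ), N₀ ≤ N → i + 2 ≤ N →
      |a N i t - AL i t| ≤ A * Real.exp (-(((N - 2 - i : ℕ) : ℝ) - v * max t 0) / ℓ) := fun i t => (hAL i t).2
  have hARr : ∀ (i : ℕ) (t : ℝ) (N : ℕ), N₀ ≤ N → i + 2 ≤ N →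
      |a N (N - 2 - i) t - AR i t| ≤ A * Real.exp (-(((N - 2 - i : ℕ) : ℝ) - v * max t 0) / ℓ) :=
    fun i t => (hAR i t).2
  have hALb := leftLayer_sub_bulk hB hALt
  have hARb := rightLayer_sub_bulk hB hARt
  have hsp := splice_estimate hℓ hA hALr hARr hALb hARb
  -- the contact function
  refine ⟨fun t => (∑' i, (AL i t - C t)) + ∑' i, (AR i t - C t), fun t => ?_, fun N hN hN1 t => (hsp N hN hN1 t).2.2,
    fun t => ?_, fun ham hCm => ?_⟩
  · -- the uniform bound
    have hgL : ∀ i, |AL i t - C t| ≤ A * Real.exp (v * max t 0 / ℓ) * Real.exp (-1 / ℓ) ^ i := fun i => by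
      rw [← cone_eq]; exact hALb i t
    have hgR : ∀ i, |AR i t - C t| ≤ A * Real.exp (v * max t 0 / ℓ) * Real.exp (-1 / ℓ) ^ i := fun i => by
      rw [← cone_eq]; exact hARb i t
    have h1 := (tsum_abs_le_of_geometric hr0 hr1 hgL).2
    have h2 := (tsum_abs_le_of_geometric hr0 hr1 hgR).2
    calc |(∑' i, (AL i t - C t)) + ∑' i, (AR i t - C t)| ≤ |∑' i, (AL i t - C t)| + |∑' i, (AR i t - C t)| :=
          abs_add_le _ _
      _ ≤ A * Real.exp (v * max t 0 / ℓ) * (1 - Real.exp (-1 / ℓ))⁻¹ +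
            A * Real.exp (v * max t 0 / ℓ) * (1 - Real.exp (-1 / ℓ))⁻¹ := add_le_add h1 h2
      _ = 2 * A * (1 - Real.exp (-1 / ℓ))⁻¹ * Real.exp (v * max t 0 / ℓ) := by ring
  · -- pointwise convergence
    have hdiv : Tendsto (fun b : ℕ => b / 2) atTop atTop := (map_div_atTop_eq_nat 2 two_pos).le
    have hpow : Tendsto (fun N : ℕ => Real.exp (-1 / ℓ) ^ ((N - 1) / 2)) atTop (𝓝 0) :=
      (tendsto_pow_atTop_nhds_zero_of_lt_one hr0 hr1).comp (hdiv.comp (tendsto_sub_atTop_nat 1))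
    have h0 : Tendsto (fun N : ℕ => 4 * A * (1 - Real.exp (-1 / ℓ))⁻¹ * Real.exp (v * max t 0 / ℓ) *
        Real.exp (-1 / ℓ) ^ ((N - 1) / 2)) atTop (𝓝 0) := by
      simpa only [mul_zero] using hpow.const_mul (4 * A * (1 - Real.exp (-1 / ℓ))⁻¹ * Real.exp (v * max t 0 / ℓ))
    refine tendsto_sub_nhds_zero_iff.1 (squeeze_zero_norm' ?_ h0)
    filter_upwards [eventually_ge_atTop (max N₀ 1)] with N hN
    rw [Real.norm_eq_abs]
    exact (hsp N (le_of_max_le_left hN) (le_of_max_le_right hN) t).2.2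
  · -- measurability
    have hALm : ∀ i, Measurable (AL i) := fun i =>
      measurable_of_tendsto_metrizable (f := fun M t => a M i t) (fun M => ham M i)
        (tendsto_pi_nhds.2 fun t => hALt i t)
    have hARm : ∀ i, Measurable (AR i) := fun i =>
      measurable_of_tendsto_metrizable (f := fun M t => a M (M - 2 - i) t) (fun M => ham M (M - 2 - i))
        (tendsto_pi_nhds.2 fun t => hARt i t)
    have hN1 : 1 ≤ max N₀ 1 := le_max_right _ _
    have h1 : Measurable fun t => ∑' i, (AL i t - C t) :=
      measurable_of_tendsto_metrizable (f := fun K t => ∑ i ∈ Finset.range K, (AL i t - C t))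
        (fun K => Finset.measurable_sum _ fun i _ => (hALm i).sub hCm)
        (tendsto_pi_nhds.2 fun t => (hsp (max N₀ 1) (le_max_left _ _) hN1 t).1.hasSum.tendsto_sum_nat)
    have h2 : Measurable fun t => ∑' i, (AR i t - C t) :=
      measurable_of_tendsto_metrizable (f := fun K t => ∑ i ∈ Finset.range K, (AR i t - C t))
        (fun K => Finset.measurable_sum _ fun i _ => (hARm i).sub hCm)
        (tendsto_pi_nhds.2 fun t => (hsp (max N₀ 1) (le_max_left _ _) hN1 t).2.1.hasSum.tendsto_sum_nat)
    exact h1.add h2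

end Main

end Summit.AtomisticToContinuum.FouriersLaw.Theorems.UniformAbelianRegularity.ZeroMeanDyadicSplice.LinearCone


/-!
## Part 2 — (M1) `stub_contactSplice` ⟸ (K3) linear cones ∧ (K2′) Cesàro decay: rows, the splice in the format of (M1), the chain
(`--supports` helper for crux stmt-AtomisticToContinuum-13416, line `Sketch`; proves the GLUE `contactSplice_of_linearCones`
whose conclusion is the registered signature of `stub_contactSplice` VERBATIM; does NOT prove the stub; closes nothing)

`c_N(t) = ∫ J·(P_t J) dμ_{N,T}` (open pinned anharmonic `N`-chain, both baths at `T`), `A^N_i(t) = Σ_k ⟨j_i(0) j_k(t)⟩_{N,T}`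
its anchored sums (`c_N = Σ_{i ≤ N−2} A^N_i`, `totalCurrentAutocorr_eq_sum_range_rows`), `C_T = D.currentCorrelation μT` for
a regular pair `(μT, D)`.  The two hypotheses of `contactSplice_of_linearCones` (neither landed, both open-problem class —
every landed light-cone / matching engine of the tree works at an `N`-INDEPENDENT horizon):
 (K3)  for every regular pair ONE set of constants `v, ℓ > 0`, `A ≥ 0`, `N₀` with
       (K3a) TWO-LENGTH LINEAR LIGHT CONE, both frames: for `N₀ ≤ N ≤ M`, `i + 2 ≤ N`, `t ≥ 0`,
             `|A^N_i(t) − A^M_i(t)| ≤ A e^{−((N−2−i) − vt)/ℓ}`, `|A^N_{N−2−i}(t) − A^M_{M−2−i}(t)| ≤ A e^{−((N−2−i) − vt)/ℓ}`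
             (a contact layer stabilises as the far bath recedes, exponentially beyond the cone);
       (K3b) LINEAR-CONE BULK IDENTIFICATION `|A^N_i(t) − C_T(t)| ≤ A e^{−(min(i,N−2−i) − vt)/ℓ}`;
 (K2′) CESÀRO DECAY OF THE CONTACT LAYER, finite-`N` form: `∀ ε ∃ τ₀ ∀ τ ≥ τ₀ ∃ N₁ ∀ N ≥ N₁: ∫_{(0,τ]} |c_N − (N−1)C_T| ≤ ετ`.
Proof (`contactSplice_of_rows`, generic in the rows): rows and bulk read at `t⁺` satisfy part 1's hypotheses; `E` := part 1's
contact function (measurable: rows by `pinnedChain_measurable_pairCorr`, bulk by `stub_witnessPositiveType`); on `(0, c₀N]`,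
`c₀ = 1/(4v)`, the splice estimate is `≤ 4Aℓ′e^{1/ℓ} e^{−N/(4ℓ)}`, so the `L¹` error is
`≤ 4Aℓ′e^{1/ℓ}(4v)⁻¹ · N e^{−N/(4ℓ)} ≤ 4Aℓ′e^{1/ℓ}(4v)⁻¹ · 4ℓ =: K` (`x ≤ eˣ`); `E` is locally integrable (`|E| ≤ 2Aℓ′e^{vτ/ℓ}`
on `(0,τ]`) and Cesàro-small by (K2′) + dominated convergence at fixed `τ` (domination by the splice estimate, pointwise
convergence `c_N − (N−1)C_T → E`).
All statements proved; `[folklore]`. No definitions.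
-/

namespace Summit.AtomisticToContinuum.FouriersLaw.Theorems.UniformAbelianRegularity.ZeroMeanDyadicSplice

open MeasureTheory Set Filter Topology

/-! ### §5 Two elementary integral facts -/

/-- **`L¹` from `L^∞` on `(0, τ]`**, junk-safe: `|f| ≤ K` on `[0, τ]` gives `∫_{(0,τ]} |f| ≤ K τ`. [folklore] -/
theorem setIntegral_abs_le_of_forall_abs_le' {f : ℝ → ℝ} {K τ : ℝ} (hτ : 0 ≤ τ)
    (hf : ∀ t ∈ Set.Icc (0 : ℝ) τ, |f t| ≤ K) : ∫ t in Set.Ioc 0 τ, |f t| ≤ K * τ := by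
  have h := norm_setIntegral_le_of_norm_le_const (μ := volume) (s := Set.Ioc (0 : ℝ) τ) (f := fun t => |f t|)
    (C := K) (by rw [Real.volume_Ioc]; exact ENNReal.ofReal_lt_top)
    (fun t ht => by simpa using hf t (Set.Ioc_subset_Icc_self ht))
  rw [Real.volume_real_Ioc_of_le hτ, sub_zero, Real.norm_eq_abs] at h
  exact (le_abs_self _).trans h

/-- `N e^{-N/(4ℓ)} ≤ 4ℓ` (`x ≤ e^x`). [folklore] -/
theorem natCast_mul_exp_neg_le {ℓ : ℝ} (hℓ : 0 < ℓ) (N : ℕ) : (N : ℝ) * Real.exp (-(N : ℝ) / (4 * ℓ)) ≤ 4 * ℓ := by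
  have h4 : 0 < 4 * ℓ := by positivity
  have h := Real.add_one_le_exp ((N : ℝ) / (4 * ℓ))
  have h1 : (N : ℝ) / (4 * ℓ) ≤ Real.exp ((N : ℝ) / (4 * ℓ)) := by linarith
  rw [show -(N : ℝ) / (4 * ℓ) = -((N : ℝ) / (4 * ℓ)) by ring, Real.exp_neg, ← div_eq_mul_inv,
    div_le_iff₀ (Real.exp_pos _)]
  calc (N : ℝ) = (N / (4 * ℓ)) * (4 * ℓ) := by field_simp
    _ ≤ Real.exp (N / (4 * ℓ)) * (4 * ℓ) := by gcongr
    _ = 4 * ℓ * Real.exp (N / (4 * ℓ)) := by ring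

/-! ### §6 The contact splice from rows (generic in the row functions) -/

/-- **Contact splice in the format of (M1), from rows.** Let `c N t` (think `c_N(t)`) be, for `N ≥ 1` and `t ≥ 0`, the sum
over `i < N-1` of rows `row N i t` (think `A^N_i(t)`), all measurable in `t`, `C` measurable. Assume the two-length linear
cones (K3a, both frames) and the linear-cone bulk identification (K3b) for the rows at `t ≥ 0`, and the Cesàro decay (K2′)
of `c N - (N-1)C`. Then the conclusion of (M1) holds for `c`: an `N`-free measurable, locally integrable, Cesàro-small `E`,
`c₀ = (4v)⁻¹`, `K = Q (4v)⁻¹ 4ℓ` with `Q = 4Aℓ′e^{1/ℓ}`, and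
`∫_{(0,c₀N]} |c N - (N-1)C - E| ≤ K` for `N ≥ max N₀ 1`. [folklore] -/
theorem contactSplice_of_rows {c : ℕ → ℝ → ℝ} {row : ℕ → ℕ → ℝ → ℝ} {C : ℝ → ℝ} {v ℓ A : ℝ} {N₀ : ℕ}
    (hv : 0 < v) (hℓ : 0 < ℓ) (hA : 0 ≤ A)
    (hcm : ∀ N : ℕ, Measurable (c N)) (hrm : ∀ N i : ℕ, Measurable (row N i)) (hCm : Measurable C)
    (hc : ∀ N : ℕ, 1 ≤ N → ∀ t : ℝ, 0 ≤ t → c N t = ∑ i ∈ Finset.range (N - 1), row N i t)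
    (hK3L : ∀ N M : ℕ, N₀ ≤ N → N ≤ M → ∀ i : ℕ, i + 2 ≤ N → ∀ t : ℝ, 0 ≤ t →
      |row N i t - row M i t| ≤ A * Real.exp (-(((N - 2 - i : ℕ) : ℝ) - v * t) / ℓ))
    (hK3R : ∀ N M : ℕ, N₀ ≤ N → N ≤ M → ∀ i : ℕ, i + 2 ≤ N → ∀ t : ℝ, 0 ≤ t →
      |row N (N - 2 - i) t - row M (M - 2 - i) t| ≤ A * Real.exp (-(((N - 2 - i : ℕ) : ℝ) - v * t) / ℓ))
    (hK3B : ∀ N : ℕ, N₀ ≤ N → ∀ i : ℕ, i + 2 ≤ N → ∀ t : ℝ, 0 ≤ t →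
      |row N i t - C t| ≤ A * Real.exp (-(((min i (N - 2 - i) : ℕ) : ℝ) - v * t) / ℓ))
    (hK2 : ∀ ε : ℝ, 0 < ε → ∃ τ₀ : ℝ, 0 < τ₀ ∧ ∀ τ : ℝ, τ₀ ≤ τ → ∃ N₁ : ℕ, ∀ N : ℕ, N₁ ≤ N →
      ∫ t in Set.Ioc 0 τ, |c N t - ((N : ℝ) - 1) * C t| ≤ ε * τ) :
    ∃ (E : ℝ → ℝ) (c₀ K : ℝ) (N₁ : ℕ), 0 < c₀ ∧ 0 ≤ K ∧ Measurable E ∧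
      (∀ τ : ℝ, 0 < τ → IntegrableOn E (Set.Ioc 0 τ)) ∧
      (∀ ε : ℝ, 0 < ε → ∃ τ₀ : ℝ, 0 < τ₀ ∧ ∀ τ : ℝ, τ₀ ≤ τ → ∫ t in Set.Ioc 0 τ, |E t| ≤ ε * τ) ∧
      (∀ N : ℕ, N₁ ≤ N → ∫ t in Set.Ioc 0 (c₀ * N), |c N t - ((N : ℝ) - 1) * C t - E t| ≤ K) := by
  obtain ⟨hr0, hr1⟩ := LinearCone.ratio_nonneg_lt_one hℓ
  -- rows and bulk read at `t⁺ = max t 0`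
  set a : ℕ → ℕ → ℝ → ℝ := fun N i t => row N i (max t 0) with ha
  set C' : ℝ → ℝ := fun t => C (max t 0) with hC'
  have ht0 : ∀ t : ℝ, 0 ≤ max t 0 := fun t => le_max_right _ _
  have hmax : Measurable fun t : ℝ => max t 0 := measurable_id.max measurable_const
  obtain ⟨E, hEb, hspl, hlim, hEm⟩ := LinearCone.exists_contactLayer (a := a) (C := C') hℓ hA
    (fun N M hN hNM i hi t => hK3L N M hN hNM i hi (max t 0) (ht0 t))
    (fun N M hN hNM i hi t => hK3R N M hN hNM i hi (max t 0) (ht0 t))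
    (fun N hN i hi t => hK3B N hN i hi (max t 0) (ht0 t))
  have hEmeas : Measurable E := hEm (fun N i => (hrm N i).comp hmax) (hCm.comp hmax)
  set ℓ' : ℝ := (1 - Real.exp (-1 / ℓ))⁻¹ with hℓ'
  have hℓ'0 : 0 ≤ ℓ' := inv_nonneg.2 (by linarith)
  -- identification at `t ≥ 0`
  have hid : ∀ N : ℕ, 1 ≤ N → ∀ t : ℝ, 0 ≤ t →
      c N t - ((N : ℝ) - 1) * C t = (∑ i ∈ Finset.range (N - 1), a N i t) - ((N : ℝ) - 1) * C' t := by
    intro N hN t ht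
    simp only [ha, hC', max_eq_left ht, hc N hN t ht]
  -- the pointwise splice bound on `[0, c₀ N]`, `c₀ = (4v)⁻¹`
  set Q : ℝ := 4 * A * ℓ' * Real.exp (1 / ℓ) with hQ
  have hQ0 : 0 ≤ Q := by rw [hQ]; positivity
  have hpt : ∀ N : ℕ, N₀ ≤ N → 1 ≤ N → ∀ t ∈ Set.Icc (0 : ℝ) ((4 * v)⁻¹ * N),
      |c N t - ((N : ℝ) - 1) * C t - E t| ≤ Q * Real.exp (-(N : ℝ) / (4 * ℓ)) := by
    intro N hN hN1 t ht
    rw [hid N hN1 t ht.1]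
    refine (hspl N hN hN1 t).trans ?_
    rw [max_eq_left ht.1]
    have hvt : v * t ≤ (N : ℝ) / 4 := by
      calc v * t ≤ v * ((4 * v)⁻¹ * N) := by gcongr; exact ht.2
        _ = N / 4 := by field_simp
    have hm : (N : ℝ) ≤ 2 * (((N - 1) / 2 : ℕ) : ℝ) + 2 := by
      exact_mod_cast (show N ≤ 2 * ((N - 1) / 2) + 2 by omega)
    have key : Real.exp (v * t / ℓ) * Real.exp (-1 / ℓ) ^ ((N - 1) / 2) ≤
        Real.exp (1 / ℓ) * Real.exp (-(N : ℝ) / (4 * ℓ)) := by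
      rw [← Real.exp_nat_mul, ← Real.exp_add, ← Real.exp_add]
      refine Real.exp_le_exp.2 ?_
      rw [show v * t / ℓ + (((N - 1) / 2 : ℕ) : ℝ) * (-1 / ℓ) = (v * t - (((N - 1) / 2 : ℕ) : ℝ)) / ℓ by ring,
        show 1 / ℓ + -(N : ℝ) / (4 * ℓ) = (1 - (N : ℝ) / 4) / ℓ by ring]
      exact div_le_div_of_nonneg_right (by linarith) hℓ.le
    calc 4 * A * ℓ' * Real.exp (v * t / ℓ) * Real.exp (-1 / ℓ) ^ ((N - 1) / 2)
        = (4 * A * ℓ') * (Real.exp (v * t / ℓ) * Real.exp (-1 / ℓ) ^ ((N - 1) / 2)) := by ring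
      _ ≤ (4 * A * ℓ') * (Real.exp (1 / ℓ) * Real.exp (-(N : ℝ) / (4 * ℓ))) :=
          mul_le_mul_of_nonneg_left key (by positivity)
      _ = Q * Real.exp (-(N : ℝ) / (4 * ℓ)) := by rw [hQ]; ring
  -- local integrability of `E`
  have hint : ∀ τ : ℝ, 0 < τ → IntegrableOn E (Set.Ioc 0 τ) := by
    intro τ hτ
    refine IntegrableOn.of_bound measure_Ioc_lt_top hEmeas.aestronglyMeasurable (2 * A * ℓ' * Real.exp (v * τ / ℓ))
      ((ae_restrict_iff' measurableSet_Ioc).2 (ae_of_all _ fun t ht => ?_))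
    rw [Real.norm_eq_abs]
    refine (hEb t).trans ?_
    rw [max_eq_left ht.1.le]
    have hexp : Real.exp (v * t / ℓ) ≤ Real.exp (v * τ / ℓ) :=
      Real.exp_le_exp.2 (div_le_div_of_nonneg_right (by nlinarith [ht.2]) hℓ.le)
    exact mul_le_mul_of_nonneg_left hexp (by positivity)
  -- Cesàro-smallness of `E` from (K2′), by dominated convergence at fixed `τ`
  have hces : ∀ ε : ℝ, 0 < ε → ∃ τ₀ : ℝ, 0 < τ₀ ∧ ∀ τ : ℝ, τ₀ ≤ τ → ∫ t in Set.Ioc 0 τ, |E t| ≤ ε * τ := by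
    intro ε hε
    obtain ⟨τ₀, hτ₀, hτ⟩ := hK2 ε hε
    refine ⟨τ₀, hτ₀, fun τ hττ => ?_⟩
    obtain ⟨N₂, hN₂⟩ := hτ τ hττ
    set Mb : ℝ := 2 * A * ℓ' * Real.exp (v * τ / ℓ) + 4 * A * ℓ' * Real.exp (v * τ / ℓ) with hMb
    have hlimI : Tendsto (fun N : ℕ => ∫ t in Set.Ioc 0 τ, |c N t - ((N : ℝ) - 1) * C t|) atTop
        (𝓝 (∫ t in Set.Ioc 0 τ, |E t|)) := by
      refine tendsto_integral_filter_of_dominated_convergence (fun _ => Mb) ?_ ?_ (integrable_const Mb) ?_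
      · exact Eventually.of_forall fun N =>
          (((hcm N).sub (hCm.const_mul _)).abs).aestronglyMeasurable
      · filter_upwards [eventually_ge_atTop (max N₀ 1)] with N hN
        refine (ae_restrict_iff' measurableSet_Ioc).2 (ae_of_all _ fun t ht => ?_)
        rw [Real.norm_eq_abs, abs_abs]
        have hE := hEb t
        have hS := hspl N (le_of_max_le_left hN) (le_of_max_le_right hN) t
        rw [← hid N (le_of_max_le_right hN) t ht.1.le] at hS
        rw [max_eq_left ht.1.le] at hE hS
        have hexp : Real.exp (v * t / ℓ) ≤ Real.exp (v * τ / ℓ) :=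
          Real.exp_le_exp.2 (div_le_div_of_nonneg_right (by nlinarith [ht.2]) hℓ.le)
        have hrm : Real.exp (-1 / ℓ) ^ ((N - 1) / 2) ≤ 1 := pow_le_one₀ hr0 hr1.le
        have hsplit : c N t - ((N : ℝ) - 1) * C t = E t + (c N t - ((N : ℝ) - 1) * C t - E t) := by ring
        calc |c N t - ((N : ℝ) - 1) * C t| = |E t + (c N t - ((N : ℝ) - 1) * C t - E t)| := by rw [← hsplit]
          _ ≤ |E t| + |c N t - ((N : ℝ) - 1) * C t - E t| := abs_add_le _ _
          _ ≤ 2 * A * ℓ' * Real.exp (v * t / ℓ) +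
                4 * A * ℓ' * Real.exp (v * t / ℓ) * Real.exp (-1 / ℓ) ^ ((N - 1) / 2) := add_le_add hE hS
          _ ≤ 2 * A * ℓ' * Real.exp (v * τ / ℓ) + 4 * A * ℓ' * Real.exp (v * τ / ℓ) * 1 := by
              gcongr
          _ = Mb := by rw [hMb]; ring
      · refine (ae_restrict_iff' measurableSet_Ioc).2 (ae_of_all _ fun t ht => ?_)
        have h1 : Tendsto (fun N : ℕ => |(∑ i ∈ Finset.range (N - 1), a N i t) - ((N : ℝ) - 1) * C' t|) atTop
            (𝓝 |E t|) := (hlim t).abs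
        refine h1.congr' ?_
        filter_upwards [eventually_ge_atTop 1] with N hN
        rw [hid N hN t ht.1.le]
    exact le_of_tendsto hlimI (eventually_atTop.2 ⟨N₂, fun N hN => hN₂ N hN⟩)
  -- assembly
  refine ⟨E, (4 * v)⁻¹, Q * (4 * v)⁻¹ * (4 * ℓ), max N₀ 1, by positivity, by positivity, hEmeas, hint, hces,
    fun N hN => ?_⟩
  have hN0 : N₀ ≤ N := le_of_max_le_left hN
  have hN1 : 1 ≤ N := le_of_max_le_right hN
  have hc0N : 0 ≤ (4 * v)⁻¹ * (N : ℝ) := by positivity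
  calc ∫ t in Set.Ioc 0 ((4 * v)⁻¹ * N), |c N t - ((N : ℝ) - 1) * C t - E t|
      ≤ Q * Real.exp (-(N : ℝ) / (4 * ℓ)) * ((4 * v)⁻¹ * N) :=
        setIntegral_abs_le_of_forall_abs_le' hc0N (hpt N hN0 hN1)
    _ = Q * (4 * v)⁻¹ * ((N : ℝ) * Real.exp (-(N : ℝ) / (4 * ℓ))) := by ring
    _ ≤ Q * (4 * v)⁻¹ * (4 * ℓ) := mul_le_mul_of_nonneg_left (natCast_mul_exp_neg_le hℓ N) (by positivity)

/-! ### §7 The chain: `c_N` as a range sum of guarded rows, and (M1) from (K3) ∧ (K2′) -/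

section Chain

open Literature.MathematicalPhysics.KineticTheory.HeatConduction OscillatorChain
open Summit.AtomisticToContinuum.FouriersLaw.Theorems.AbelThermodynamicLimit.SeriesLawAtEveryLaplaceFrequency
  (totalCurrentAutocorr_eq_sum_sum_pairCorr pinnedChain_measurable_totalCurrentAutocorr)
open Summit.AtomisticToContinuum.FouriersLaw.Theorems.AbelThermodynamicLimit.LoomisCompactHorizonWitness
  (pinnedChain_measurable_pairCorr stub_witnessPositiveType)

/-- **`c_N(t) = Σ_{i < N-1} A^N_i(t)`** with the rows indexed by `ℕ` and guarded (`i + 2 ≤ N` = genuine bond): the double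
pair-correlation sum `totalCurrentAutocorr_eq_sum_sum_pairCorr` with the phantom row `i = N-1` dropped
(`bondCurrent_eq_zero_of_last`). [folklore] -/
theorem totalCurrentAutocorr_eq_sum_range_rows {ω₂ lam β γ : ℝ} (hω : 0 < ω₂) (hl : 0 < lam) (hβ : 0 < β)
    (hγ : 0 < γ) {T : ℝ} (hT : 0 < T) {N : ℕ} (hN : 1 ≤ N) (t : ℝ) :
    (∫ z, (∑ i : Fin N, (pinnedChain ω₂ lam β γ).bondCurrent N i z) *
        (∫ y, (∑ i : Fin N, (pinnedChain ω₂ lam β γ).bondCurrent N i y)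
          ∂((pinnedChain ω₂ lam β γ).transitionKernel N T T t.toNNReal z))
      ∂((pinnedChain ω₂ lam β γ).gibbsMeasure N T)) =
    ∑ i ∈ Finset.range (N - 1), (if h : i + 2 ≤ N then
      ∑ k : Fin N, ∫ z, (pinnedChain ω₂ lam β γ).bondCurrent N ⟨i, by omega⟩ z *
        (∫ y, (pinnedChain ω₂ lam β γ).bondCurrent N k y
          ∂((pinnedChain ω₂ lam β γ).transitionKernel N T T t.toNNReal z))
        ∂((pinnedChain ω₂ lam β γ).gibbsMeasure N T) else 0) := by
  obtain ⟨n, rfl⟩ : ∃ n, N = n + 1 := ⟨N - 1, by omega⟩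
  set P := pinnedChain ω₂ lam β γ with hP
  rw [totalCurrentAutocorr_eq_sum_sum_pairCorr hω hl hβ hγ (Nat.succ_pos n) hT, Fin.sum_univ_castSucc]
  have hlast : (∑ k : Fin (n + 1), ∫ z, P.bondCurrent (n + 1) (Fin.last n) z *
      (∫ y, P.bondCurrent (n + 1) k y ∂(P.transitionKernel (n + 1) T T t.toNNReal z))
      ∂(P.gibbsMeasure (n + 1) T)) = 0 := by
    refine Finset.sum_eq_zero fun k _ => ?_
    have h0 : ∀ z, P.bondCurrent (n + 1) (Fin.last n) z = 0 := fun z =>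
      P.bondCurrent_eq_zero_of_last (n + 1) (Fin.last n) (by simp) z
    simp only [h0, zero_mul, integral_zero]
  rw [hlast, add_zero, Nat.add_sub_cancel]
  set g : ℕ → ℝ := fun i => if h : i + 2 ≤ n + 1 then
      ∑ k : Fin (n + 1), ∫ z, P.bondCurrent (n + 1) ⟨i, by omega⟩ z *
        (∫ y, P.bondCurrent (n + 1) k y ∂(P.transitionKernel (n + 1) T T t.toNNReal z))
        ∂(P.gibbsMeasure (n + 1) T) else 0 with hg
  show _ = ∑ i ∈ Finset.range n, g i
  rw [← Fin.sum_univ_eq_sum_range g n]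
  refine Finset.sum_congr rfl fun i _ => ?_
  simp only [hg, dif_pos (show i.val + 2 ≤ n + 1 by omega)]
  rfl

/-- **(M1) `stub_contactSplice` ⟸ (K3) linear cones ∧ (K2′) Cesàro decay of the contact layer.**  (K3) = for every
regular pair, ONE set of cone constants `v, ℓ > 0`, `A ≥ 0`, `N₀` with (K3a) the two-length linear light cone for the
anchored sums `A^N_i(t) = Σ_k ⟨j_i(0) j_k(t)⟩_{N,T}` in both frames and (K3b) the linear-cone bulk identification
`|A^N_i(t) - C_T(t)| ≤ A e^{-(depth - vt)/ℓ}`; (K2′) = Cesàro decay of `c_N - (N-1)C_T` for `N` large depending on the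
horizon. The conclusion is the registered signature of `stub_contactSplice` (crux stmt-AtomisticToContinuum-13416, line
`Sketch`) VERBATIM: `E` = the two one-bath layers minus bulk (`LinearCone.exists_contactLayer`), `c₀ = (4v)⁻¹`,
`K = 4Aℓ′e^{1/ℓ}(4v)⁻¹4ℓ` (`contactSplice_of_rows`); measurability of `C_T` is the landed `stub_witnessPositiveType`.
Neither (K3) nor (K2′) is a landed theorem (open-problem class: no tree engine reaches `t ≍ N`). [folklore] -/
theorem contactSplice_of_linearCones
    (hK3 : ∀ ω₂ lam β γ : ℝ, 0 < ω₂ → 0 < lam → 0 < β → 0 < γ → ∀ T : ℝ, 0 < T →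
      ∀ (μT : Measure ChainConfig) (D : InfiniteChainDynamics (pinnedChain ω₂ lam β γ)),
        (pinnedChain ω₂ lam β γ).IsChainGibbsMeasure T μT → IsShiftInvariant μT →
        (pinnedChain ω₂ lam β γ).HasSuperstabilityEstimate μT →
        D.carrier ⊆ (pinnedChain ω₂ lam β γ).bmGood → D.PreservesMeasure μT →
        (∀ t : ℝ, D.HasAbsConvergentCorrelation μT t) →
        ∃ (v ℓ A : ℝ) (N₀ : ℕ), 0 < v ∧ 0 < ℓ ∧ 0 ≤ A ∧
          (∀ (N M : ℕ) (hN : N₀ ≤ N) (hNM : N ≤ M) (i : ℕ) (hi : i + 2 ≤ N) (t : ℝ), 0 ≤ t →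
            |(∑ k : Fin N, ∫ z, (pinnedChain ω₂ lam β γ).bondCurrent N ⟨i, by omega⟩ z *
                  (∫ y, (pinnedChain ω₂ lam β γ).bondCurrent N k y
                    ∂((pinnedChain ω₂ lam β γ).transitionKernel N T T t.toNNReal z))
                  ∂((pinnedChain ω₂ lam β γ).gibbsMeasure N T)) -
                ∑ k : Fin M, ∫ z, (pinnedChain ω₂ lam β γ).bondCurrent M ⟨i, by omega⟩ z *
                  (∫ y, (pinnedChain ω₂ lam β γ).bondCurrent M k y
                    ∂((pinnedChain ω₂ lam β γ).transitionKernel M T T t.toNNReal z))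
                  ∂((pinnedChain ω₂ lam β γ).gibbsMeasure M T)| ≤
              A * Real.exp (-(((N - 2 - i : ℕ) : ℝ) - v * t) / ℓ) ∧
            |(∑ k : Fin N, ∫ z, (pinnedChain ω₂ lam β γ).bondCurrent N ⟨N - 2 - i, by omega⟩ z *
                  (∫ y, (pinnedChain ω₂ lam β γ).bondCurrent N k y
                    ∂((pinnedChain ω₂ lam β γ).transitionKernel N T T t.toNNReal z))
                  ∂((pinnedChain ω₂ lam β γ).gibbsMeasure N T)) -
                ∑ k : Fin M, ∫ z, (pinnedChain ω₂ lam β γ).bondCurrent M ⟨M - 2 - i, by omega⟩ z *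
                  (∫ y, (pinnedChain ω₂ lam β γ).bondCurrent M k y
                    ∂((pinnedChain ω₂ lam β γ).transitionKernel M T T t.toNNReal z))
                  ∂((pinnedChain ω₂ lam β γ).gibbsMeasure M T)| ≤
              A * Real.exp (-(((N - 2 - i : ℕ) : ℝ) - v * t) / ℓ)) ∧
          (∀ (N : ℕ) (hN : N₀ ≤ N) (i : ℕ) (hi : i + 2 ≤ N) (t : ℝ), 0 ≤ t →
            |(∑ k : Fin N, ∫ z, (pinnedChain ω₂ lam β γ).bondCurrent N ⟨i, by omega⟩ z *
                  (∫ y, (pinnedChain ω₂ lam β γ).bondCurrent N k y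
                    ∂((pinnedChain ω₂ lam β γ).transitionKernel N T T t.toNNReal z))
                  ∂((pinnedChain ω₂ lam β γ).gibbsMeasure N T)) - D.currentCorrelation μT t| ≤
              A * Real.exp (-(((min i (N - 2 - i) : ℕ) : ℝ) - v * t) / ℓ)))
    (hK2 : ∀ ω₂ lam β γ : ℝ, 0 < ω₂ → 0 < lam → 0 < β → 0 < γ → ∀ T : ℝ, 0 < T →
      ∀ (μT : Measure ChainConfig) (D : InfiniteChainDynamics (pinnedChain ω₂ lam β γ)),
        (pinnedChain ω₂ lam β γ).IsChainGibbsMeasure T μT → IsShiftInvariant μT →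
        (pinnedChain ω₂ lam β γ).HasSuperstabilityEstimate μT →
        D.carrier ⊆ (pinnedChain ω₂ lam β γ).bmGood → D.PreservesMeasure μT →
        (∀ t : ℝ, D.HasAbsConvergentCorrelation μT t) →
        ∀ ε : ℝ, 0 < ε → ∃ τ₀ : ℝ, 0 < τ₀ ∧ ∀ τ : ℝ, τ₀ ≤ τ → ∃ N₁ : ℕ, ∀ N : ℕ, N₁ ≤ N →
          let J : PhaseSpace N → ℝ := fun z => ∑ i : Fin N, (pinnedChain ω₂ lam β γ).bondCurrent N i z
          ∫ t in Set.Ioc 0 τ, |(∫ z, J z * (∫ y, J y ∂((pinnedChain ω₂ lam β γ).transitionKernel N T T t.toNNReal z))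
              ∂((pinnedChain ω₂ lam β γ).gibbsMeasure N T)) - ((N : ℝ) - 1) * D.currentCorrelation μT t| ≤ ε * τ) :
    ∀ ω₂ lam β γ : ℝ, 0 < ω₂ → 0 < lam → 0 < β → 0 < γ → ∀ T : ℝ, 0 < T → ∀ (μT : MeasureTheory.Measure Literature.MathematicalPhysics.KineticTheory.HeatConduction.ChainConfig) (D : Literature.MathematicalPhysics.KineticTheory.HeatConduction.InfiniteChainDynamics (Literature.MathematicalPhysics.KineticTheory.HeatConduction.pinnedChain ω₂ lam β γ)), (Literature.MathematicalPhysics.KineticTheory.HeatConduction.pinnedChain ω₂ lam β γ).IsChainGibbsMeasure T μT → Literature.MathematicalPhysics.KineticTheory.HeatConduction.IsShiftInvariant μT → (Literature.MathematicalPhysics.KineticTheory.HeatConduction.pinnedChain ω₂ lam β γ).HasSuperstabilityEstimate μT → D.carrier ⊆ (Literature.MathematicalPhysics.KineticTheory.HeatConduction.pinnedChain ω₂ lam β γ).bmGood → D.PreservesMeasure μT → (∀ t : ℝ, D.HasAbsConvergentCorrelation μT t) → ∃ (E : ℝ → ℝ) (c₀ K : ℝ) (N₁ : ℕ), 0 <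 c₀ ∧ 0 ≤ K ∧ Measurable E ∧ (∀ τ : ℝ, 0 < τ → MeasureTheory.IntegrableOn E (Set.Ioc 0 τ)) ∧ (∀ ε : ℝ, 0 < ε → ∃ τ₀ : ℝ, 0 < τ₀ ∧ ∀ τ : ℝ, τ₀ ≤ τ → ∫ t in Set.Ioc 0 τ, |E t| ≤ ε * τ) ∧ (∀ N : ℕ, N₁ ≤ N → let J : Literature.MathematicalPhysics.KineticTheory.HeatConduction.PhaseSpace N → ℝ := fun z => ∑ i : Fin N, (Literature.MathematicalPhysics.KineticTheory.HeatConduction.pinnedChain ω₂ lam β γ).bondCurrent N i z; ∫ t in Set.Ioc 0 (c₀ * N), |(∫ z, J z * (∫ y, J y ∂((Literature.MathematicalPhysics.KineticTheory.HeatConduction.pinnedChain ω₂ lam β γ).transitionKernel N T T t.toNNReal z)) ∂((Literature.MathematicalPhysics.KineticTheory.HeatConduction.pinnedChain ω₂ lam β γ).gibbsMeasure N T)) - ((N:ℝ) - 1) * D.currentCorrelation μT t - E t| ≤ K) := by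
  intro ω₂ lam β γ hω hl hβ hγ T hT μT D hG hS hss hcar hP hAC
  obtain ⟨hCm, -, -⟩ := stub_witnessPositiveType ω₂ lam β γ hω hl hβ hγ T hT μT D hG hS hss hcar hP hAC
  obtain ⟨v, ℓ, A, N₀, hv, hℓ, hA, hcone, hbulk⟩ := hK3 ω₂ lam β γ hω hl hβ hγ T hT μT D hG hS hss hcar hP hAC
  have hK2' := hK2 ω₂ lam β γ hω hl hβ hγ T hT μT D hG hS hss hcar hP hAC
  set row : ℕ → ℕ → ℝ → ℝ := fun N i t => if h : i + 2 ≤ N then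
      ∑ k : Fin N, ∫ z, (pinnedChain ω₂ lam β γ).bondCurrent N ⟨i, by omega⟩ z *
        (∫ y, (pinnedChain ω₂ lam β γ).bondCurrent N k y
          ∂((pinnedChain ω₂ lam β γ).transitionKernel N T T t.toNNReal z))
        ∂((pinnedChain ω₂ lam β γ).gibbsMeasure N T) else 0
    with hrow
  have hrm : ∀ N i : ℕ, Measurable (row N i) := by
    intro N i
    by_cases hi : i + 2 ≤ N
    · simp only [hrow, dif_pos hi]
      exact Finset.measurable_sum _ fun k _ => pinnedChain_measurable_pairCorr hω hl.le hβ hγ hT _ k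
    · simp only [hrow, dif_neg hi]
      exact measurable_const
  obtain ⟨E, c₀, K, N₁, hc₀, hK0, hEm, hEi, hEc, hmain⟩ := contactSplice_of_rows
    (c := fun N t => ∫ z, (∑ i : Fin N, (pinnedChain ω₂ lam β γ).bondCurrent N i z) *
      (∫ y, (∑ i : Fin N, (pinnedChain ω₂ lam β γ).bondCurrent N i y)
        ∂((pinnedChain ω₂ lam β γ).transitionKernel N T T t.toNNReal z)) ∂((pinnedChain ω₂ lam β γ).gibbsMeasure N T))
    (row := row) (C := D.currentCorrelation μT) hv hℓ hA
    (fun N => pinnedChain_measurable_totalCurrentAutocorr hω hl.le hβ hγ hT) hrm hCm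
    (fun N hN t _ => by
      simp only [hrow]
      exact totalCurrentAutocorr_eq_sum_range_rows hω hl hβ hγ hT hN t)
    (fun N M hN hNM i hi t ht => by
      have hiM : i + 2 ≤ M := hi.trans hNM
      simp only [hrow, dif_pos hi, dif_pos hiM]
      exact (hcone N M hN hNM i hi t ht).1)
    (fun N M hN hNM i hi t ht => by
      have h1 : N - 2 - i + 2 ≤ N := by omega
      have h2 : M - 2 - i + 2 ≤ M := by omega
      simp only [hrow, dif_pos h1, dif_pos h2]
      exact (hcone N M hN hNM i hi t ht).2)
    (fun N hN i hi t ht => by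
      simp only [hrow, dif_pos hi]
      exact hbulk N hN i hi t ht)
    hK2'
  exact ⟨E, c₀, K, N₁, hc₀, hK0, hEm, hEi, hEc, fun N hN => hmain N hN⟩

end Chain

end Summit.AtomisticToContinuum.FouriersLaw.Theorems.UniformAbelianRegularity.ZeroMeanDyadicSplice

end
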